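import Summits.QuantumAdvantage.QuantumAdvantage.Theorems.LinnikCubicClassGroupsDegreeOnePrimesEscapePerCharacterDeficit
import Literature.NumberTheory.LFunctions.ClassGroupLogFreeTheorem14
import HarnessLib

/-!
# T4 in DEGREE-LOCAL form: the one-sided per-character deficit from the log-free zero-density
# estimate at ONE degree (and its discharge at degrees `n ≤ 4`)

Topic `Summits/QuantumAdvantage/QuantumAdvantage/Theorems`, helper for the crux `DegreeOnePrimesEscape`
(stmt-QuantumAdvantage-11543) of route `LinnikCubicClassGroups`; cell B2b-1 (linnik-cubic), PART B.
HONEST FRAMING: the value of this file is a THEOREM — not summit progress.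

The landed stub T4 `stub_perCharacterDeficit_of_density` (`…PerCharacterDeficit.lean`, line
`subgroup-orthogonality-escape`) takes the log-free zero-density estimate for the class group `L`-functions
`{L₀(s,χ)}_{χ ≠ 1}` in EVERY degree as one hypothesis (`∀ n, ∃ c_D C_D, …`), although its proof at degree
`n` reads only the degree-`n` instance. Here the same three proofs (`density_oneChar`,
`thetaChar_le_of_density`, the stub) are re-run with the hypothesis at ONE degree
(`density_oneChar_local`, `thetaChar_le_of_density_local`, `perCharacterDeficit_of_density_local`), and the
hypothesis is DISCHARGED for `n ≤ 4` by the tree's `logFreeDensity_classGroup`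
(`perCharacterDeficitκ_of_le_four`): for `1 < n ≤ 4` and `A ≥ 0` there is `C₂` such that for every `K`
of degree `n` with `κ_K ≥ Q^{−A}`, every `χ ≠ 1` and every `x ≥ Q^{C₂}`,
`8 Σ_C Re χ(C) · #{𝔭 ∈ C : N𝔭 prime ≤ x} ≤ Li(x)`. The `n = 3` case feeds `CubicEscape`.
-/

noncomputable section

open Complex Real
open scoped NumberField nonZeroDivisors
open Literature.NumberTheory.LFunctions Literature.NumberTheory.LFunctions.NumberField
  Literature.NumberTheory.LFunctions.AbelianDensity Literature.NumberTheory.LFunctions.LogFreeLocal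
  Literature.NumberTheory.LFunctions.TZWeight

namespace Summit.QuantumAdvantage.QuantumAdvantage.Theorems.DegreeOnePrimesEscape

open scoped Classical in
/-- **The density hypothesis for one character, in `Q`-form — DEGREE-LOCAL version** of the landed
`density_oneChar`: the log-free zero-density estimate is assumed for the ONE degree `n` only. From the log-free zero-density
estimate for the family `{L₀(s,χ)}_{χ ≠ 1}` in degree `n`, for every
real `A`: with `a = max A 4` and the SAME constants `c_D, C_D`, for every `K` of degree `n > 1` with
`κ_K ≥ Q^{−A}`, every `χ ≠ 1`, `T ≥ 1`, every finite set `u` of zeros of `L₀(·,χ)` with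
`1/4 ≤ β < 1`, `|γ| ≤ T`, and every `α ≤ 1`:
`Σ_{ρ ∈ u, β ≥ α} m(ρ) ≤ C_D e^{c_D(a log Q + log(T+4))(1−α)}`. -/
theorem density_oneChar_local
    (n : ℕ) (hn : 1 < n) (A : ℝ)
    (hD : ∃ c_D C_D : ℝ, 0 < c_D ∧ 0 < C_D ∧
      ∀ (K : Type) [Field K] [NumberField K], Module.finrank ℚ K = n →
        (∀ χ : ClassGroup (𝓞 K) →* ℂˣ, χ ≠ 1 → ∀ ρ : ℂ,
          Literature.NumberTheory.LFunctions.NumberField.classGroupLFunction₀ K χ ρ = 0 → ρ.re < 1) →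
        ∀ P : ℝ, 2 ≤ P → ((NumberField.discr K).natAbs : ℝ) ≤ P →
          (Fintype.card (ClassGroup (𝓞 K)) : ℝ) ≤ P → P⁻¹ ≤ NumberField.dedekindZeta_residue K →
        ∀ Z : (ClassGroup (𝓞 K) →* ℂˣ) → Finset ℂ,
          (∀ χ : ClassGroup (𝓞 K) →* ℂˣ, χ ≠ 1 → ∀ ρ ∈ Z χ,
              Literature.NumberTheory.LFunctions.NumberField.classGroupLFunction₀ K χ ρ = 0 ∧
                1 / 4 ≤ ρ.re ∧ ρ.re < 1 ∧ |ρ.im| ≤ P) →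
          ∀ α : ℝ, 0 ≤ α → α ≤ 1 →
            ∑ ψ : AddChar (Additive (ClassGroup (𝓞 K))) ℂ with ψ ≠ 0,
              ∑ ρ ∈ Z (Literature.NumberTheory.LFunctions.AbelianDensity.toMulHom ψ).toHomUnits with α ≤ ρ.re,
                (Literature.NumberTheory.LFunctions.LogFreeLocal.zeroOrder
                  (Literature.NumberTheory.LFunctions.NumberField.classGroupLFunction₀ K
                    (Literature.NumberTheory.LFunctions.AbelianDensity.toMulHom ψ).toHomUnits) ρ : ℝ)
                  ≤ C_D * P ^ (c_D * (1 - α))) :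
    ∃ c_D C_D : ℝ, 0 < c_D ∧ 0 < C_D ∧
    ∀ (K : Type) [Field K] [NumberField K], Module.finrank ℚ K = n →
      ThornerZaman.condQn K ^ (-A) ≤ NumberField.dedekindZeta_residue K →
      ∀ χ : ClassGroup (𝓞 K) →* ℂˣ, χ ≠ 1 →
      ∀ T : ℝ, 1 ≤ T → ∀ u : Finset ℂ,
        (∀ ρ ∈ u, classGroupLFunction₀ K χ ρ = 0 ∧ 1 / 4 ≤ ρ.re ∧ ρ.re < 1 ∧ |ρ.im| ≤ T) →
        ∀ α : ℝ, α ≤ 1 →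
          ∑ ρ ∈ u with α ≤ ρ.re, (analyticOrderNatAt (classGroupLFunction₀ K χ) ρ : ℝ) ≤
            C_D * Real.exp (c_D * (max A 4 * Real.log (ThornerZaman.condQn K) + Real.log (T + 4))) ^ (1 - α) := by
  obtain ⟨c_D, C_D, hc, hC, hdens⟩ := hD
  refine ⟨c_D, C_D, hc, hC, fun K _ _ hKn hκ χ hχ T hT u hu α hα1 ↦ ?_⟩
  have hK : 1 < Module.finrank ℚ K := by rw [hKn]; exact hn
  set a : ℝ := max A 4 with ha
  set Q : ℝ := ThornerZaman.condQn K with hQ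
  have hQ12 : (12 : ℝ) ≤ Q := ThornerZaman.twelve_le_condQn (K := K) hK
  have hQ1 : (1 : ℝ) ≤ Q := by linarith
  set P : ℝ := Q ^ a * (T + 2) with hP
  obtain ⟨hP2, hdP, hhP, hκP, hTP⟩ :=
    sizeParam_admissible K hK (le_max_left _ _) (le_max_right _ _) hT hκ
  -- clamp `α` at `0`
  set α' : ℝ := max α 0 with hα'
  have hα'0 : 0 ≤ α' := le_max_right _ _
  have hα'1 : α' ≤ 1 := max_le hα1 zero_le_one
  have hfilter : u.filter (fun ρ ↦ α ≤ ρ.re) = u.filter (fun ρ ↦ α' ≤ ρ.re) := by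
    refine Finset.filter_congr fun ρ hρ ↦ ?_
    have := (hu ρ hρ).2.1
    rw [hα', max_le_iff]
    exact ⟨fun h ↦ ⟨h, by linarith⟩, fun h ↦ h.1⟩
  rw [hfilter]
  -- the zero sets: `u` at `χ`, empty elsewhere
  set Z : (ClassGroup (𝓞 K) →* ℂˣ) → Finset ℂ := fun χ' ↦ if χ' = χ then u else ∅ with hZ
  have hline : ∀ χ' : ClassGroup (𝓞 K) →* ℂˣ, χ' ≠ 1 → ∀ ρ : ℂ, classGroupLFunction₀ K χ' ρ = 0 → ρ.re < 1 := by
    intro χ' hχ' ρ h0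
    by_contra h1; rw [not_lt] at h1
    exact classGroupLFunction₀_ne_zero_of_one_le_re hχ' h1 h0
  have hZok : ∀ χ' : ClassGroup (𝓞 K) →* ℂˣ, χ' ≠ 1 → ∀ ρ ∈ Z χ',
      classGroupLFunction₀ K χ' ρ = 0 ∧ 1 / 4 ≤ ρ.re ∧ ρ.re < 1 ∧ |ρ.im| ≤ P := by
    intro χ' _ ρ hρ
    rw [hZ] at hρ; dsimp only at hρ
    by_cases hc' : χ' = χ
    · rw [if_pos hc'] at hρ
      subst hc'
      obtain ⟨h0, h14, h1, hT'⟩ := hu ρ hρ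
      exact ⟨h0, h14, h1, hT'.trans hTP⟩
    · rw [if_neg hc'] at hρ; exact absurd hρ (Finset.notMem_empty _)
  have key := hdens K hKn hline P hP2 hdP hhP hκP Z hZok α' hα'0 hα'1
  -- the character `ψ₀` with `χ_{ψ₀} = χ`
  obtain ⟨ψ₀, hψ₀⟩ := exists_toHomUnits_toMulHom_eq χ
  have hψ₀0 : ψ₀ ≠ 0 := by
    rintro rfl
    rw [toHomUnits_toMulHom_zero] at hψ₀
    exact hχ hψ₀.symm
  have hsingle : ∑ ρ ∈ u with α' ≤ ρ.re, (analyticOrderNatAt (classGroupLFunction₀ K χ) ρ : ℝ) ≤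
      ∑ ψ : AddChar (Additive (ClassGroup (𝓞 K))) ℂ with ψ ≠ 0,
        ∑ ρ ∈ Z (toMulHom ψ).toHomUnits with α' ≤ ρ.re,
          (zeroOrder (classGroupLFunction₀ K (toMulHom ψ).toHomUnits) ρ : ℝ) := by
    have hmem : ψ₀ ∈ Finset.univ.filter (fun ψ : AddChar (Additive (ClassGroup (𝓞 K))) ℂ ↦ ψ ≠ 0) := by
      rw [Finset.mem_filter]; exact ⟨Finset.mem_univ _, hψ₀0⟩
    refine le_trans (le_of_eq ?_) (Finset.single_le_sum (fun ψ _ ↦ Finset.sum_nonneg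
      fun ρ _ ↦ Nat.cast_nonneg _) hmem)
    rw [hψ₀, hZ]; dsimp only; rw [if_pos rfl]; rfl
  refine hsingle.trans (key.trans ?_)
  -- `P^{c_D(1-α')} ≤ exp(c_D(a log Q + log(T+4)))^{1-α}`
  have hP1 : (1 : ℝ) ≤ P := by linarith
  have hQa0 : 0 < Q ^ a := Real.rpow_pos_of_pos (by linarith) _
  have hPexp : P ≤ Real.exp (a * Real.log Q + Real.log (T + 4)) := by
    rw [Real.exp_add, Real.exp_log (by linarith), show a * Real.log Q = Real.log (Q ^ a) by
      rw [Real.log_rpow (by linarith)], Real.exp_log hQa0, hP]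
    nlinarith
  set B : ℝ := Real.exp (c_D * (a * Real.log Q + Real.log (T + 4))) with hBdef
  have h1α : 0 ≤ 1 - α' := by linarith
  have hαα : 1 - α' ≤ 1 - α := by rw [hα']; exact sub_le_sub_left (le_max_left _ _) _
  have hB1 : 1 ≤ B := Real.one_le_exp (by
    have : 0 ≤ Real.log Q := Real.log_nonneg hQ1
    have : 0 ≤ Real.log (T + 4) := Real.log_nonneg (by linarith)
    have : 0 ≤ a := le_trans (by norm_num) (le_max_right A 4)
    positivity)
  have hpow : P ^ (c_D * (1 - α')) ≤ B ^ (1 - α) := by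
    calc P ^ (c_D * (1 - α')) = (P ^ c_D) ^ (1 - α') := by rw [Real.rpow_mul (by linarith)]
      _ ≤ (Real.exp (a * Real.log Q + Real.log (T + 4)) ^ c_D) ^ (1 - α') :=
          Real.rpow_le_rpow (by positivity) (Real.rpow_le_rpow (by linarith) hPexp hc.le) h1α
      _ = B ^ (1 - α') := by rw [hBdef, ← Real.exp_mul]; ring_nf
      _ ≤ B ^ (1 - α) := Real.rpow_le_rpow_of_exponent_le hB1 hαα
  exact mul_le_mul_of_nonneg_left hpow hC.le


set_option maxHeartbeats 800000 in
open scoped Classical in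
/-- **`Σ_C Re χ(C) θ_C(t) ≤ t/20` for `t ≥ Q^{a₂}`** (DEGREE-LOCAL version of the landed `thetaChar_le_of_density`), for every `K` of degree `n > 1` with
`κ_K ≥ Q^{−A}` and every `χ ≠ 1`, under the log-free density hypothesis (smoothed bound
`re_coefFordK_tzTest_le_mul` at `η = 1/40` + signed unsmoothing + absorption). -/
theorem thetaChar_le_of_density_local
    (n : ℕ) (hn : 1 < n) (A : ℝ)
    (hD : ∃ c_D C_D : ℝ, 0 < c_D ∧ 0 < C_D ∧
      ∀ (K : Type) [Field K] [NumberField K], Module.finrank ℚ K = n →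
        (∀ χ : ClassGroup (𝓞 K) →* ℂˣ, χ ≠ 1 → ∀ ρ : ℂ,
          Literature.NumberTheory.LFunctions.NumberField.classGroupLFunction₀ K χ ρ = 0 → ρ.re < 1) →
        ∀ P : ℝ, 2 ≤ P → ((NumberField.discr K).natAbs : ℝ) ≤ P →
          (Fintype.card (ClassGroup (𝓞 K)) : ℝ) ≤ P → P⁻¹ ≤ NumberField.dedekindZeta_residue K →
        ∀ Z : (ClassGroup (𝓞 K) →* ℂˣ) → Finset ℂ,
          (∀ χ : ClassGroup (𝓞 K) →* ℂˣ, χ ≠ 1 → ∀ ρ ∈ Z χ,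
              Literature.NumberTheory.LFunctions.NumberField.classGroupLFunction₀ K χ ρ = 0 ∧
                1 / 4 ≤ ρ.re ∧ ρ.re < 1 ∧ |ρ.im| ≤ P) →
          ∀ α : ℝ, 0 ≤ α → α ≤ 1 →
            ∑ ψ : AddChar (Additive (ClassGroup (𝓞 K))) ℂ with ψ ≠ 0,
              ∑ ρ ∈ Z (Literature.NumberTheory.LFunctions.AbelianDensity.toMulHom ψ).toHomUnits with α ≤ ρ.re,
                (Literature.NumberTheory.LFunctions.LogFreeLocal.zeroOrder
                  (Literature.NumberTheory.LFunctions.NumberField.classGroupLFunction₀ K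
                    (Literature.NumberTheory.LFunctions.AbelianDensity.toMulHom ψ).toHomUnits) ρ : ℝ)
                  ≤ C_D * P ^ (c_D * (1 - α))) :
    ∃ a₂ : ℝ, 1 ≤ a₂ ∧ ∀ (K : Type) [Field K] [NumberField K], Module.finrank ℚ K = n →
      ThornerZaman.condQn K ^ (-A) ≤ NumberField.dedekindZeta_residue K →
      ∀ χ : ClassGroup (𝓞 K) →* ℂˣ, χ ≠ 1 → ∀ t : ℝ, ThornerZaman.condQn K ^ a₂ ≤ t →
        ∑ C, (χ C : ℂ).re * chebyshevThetaIdealClass K C t ≤ 1 / 20 * t := by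
  obtain ⟨c_D, C_D, hc, hC, hdens⟩ := density_oneChar_local n hn A hD
  have ha : (1 : ℝ) ≤ max A 4 := le_trans (by norm_num) (le_max_right _ _)
  obtain ⟨ν, a₁, hν0, hν64, ha₁, hsm⟩ :=
    re_coefFordK_tzTest_le_mul n hn hc hC ha (η := 1 / 40) (by norm_num)
  set ℓ : ℝ := 1 / ν * Real.log (44 * ((n : ℝ) + 1) / (ν * (1 / 40))) with hℓ
  refine ⟨max a₁ (max 1 ℓ), le_trans (le_max_left _ _) (le_max_right _ _),
    fun K _ _ hKn hκ χ hχ t ht ↦ ?_⟩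
  have hK : 1 < Module.finrank ℚ K := by rw [hKn]; exact hn
  set Q : ℝ := ThornerZaman.condQn K with hQ
  have hQ12 : (12 : ℝ) ≤ Q := ThornerZaman.twelve_le_condQn (K := K) hK
  have hQ1 : (1 : ℝ) < Q := by linarith
  have ha₂1 : (1 : ℝ) ≤ max a₁ (max 1 ℓ) := le_trans (le_max_left _ _) (le_max_right _ _)
  have hta₁ : Q ^ a₁ ≤ t := le_trans (Real.rpow_le_rpow_of_exponent_le hQ1.le (le_max_left _ _)) ht
  have htQ : Q ≤ t := by
    have : Q ^ (1 : ℝ) ≤ Q ^ max a₁ (max 1 ℓ) := Real.rpow_le_rpow_of_exponent_le hQ1.le ha₂1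
    rw [Real.rpow_one] at this; linarith
  have ht1 : 1 < t := by linarith
  have ht0 : 0 < t := by linarith
  have hlog12 : (2 : ℝ) ≤ Real.log 12 := by
    rw [Real.le_log_iff_exp_le (by norm_num)]
    have := Real.exp_one_lt_d9
    have h : Real.exp 2 = Real.exp 1 * Real.exp 1 := by rw [← Real.exp_add]; norm_num
    rw [h]; nlinarith [Real.exp_pos (1:ℝ)]
  have hlogQ : 2 ≤ Real.log Q := hlog12.trans (Real.log_le_log (by norm_num) hQ12)
  have hlogt : max a₁ (max 1 ℓ) * Real.log Q ≤ Real.log t := by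
    have := Real.log_le_log (by positivity) ht
    rwa [Real.log_rpow (by linarith)] at this
  -- smoothed bound at `t`
  have h1 := hsm K hKn χ hχ (hdens K hKn hκ χ hχ) t hta₁
  -- unsmoothing
  have hε0 : 0 < t ^ (-ν) := Real.rpow_pos_of_pos ht0 _
  have hε1 : t ^ (-ν) ≤ 1 := Real.rpow_le_one_of_one_le_of_nonpos ht1.le (by linarith)
  have h2 := thetaChar_le_re_coefFordK_add (K := K) χ ht1 hε0 hε1
  rw [hKn] at h2
  -- absorption
  have hte : Real.exp 1 ≤ t := by
    have := Real.exp_one_lt_d9; linarith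
  have hlarge : 2 / ν * Real.log (44 * ((n : ℝ) + 1) / (ν * (1 / 40))) ≤ Real.log t := by
    have hℓle : ℓ ≤ max a₁ (max 1 ℓ) := le_trans (le_max_right _ _) (le_max_right _ _)
    have h0 : 0 ≤ max a₁ (max 1 ℓ) := by linarith
    have : 2 * ℓ ≤ Real.log t := by nlinarith
    rw [hℓ] at this
    calc 2 / ν * Real.log (44 * ((n : ℝ) + 1) / (ν * (1 / 40)))
        = 2 * (1 / ν * Real.log (44 * ((n : ℝ) + 1) / (ν * (1 / 40)))) := by ring
      _ ≤ Real.log t := this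
  have h3 := unsmoothing_small (Nat.cast_nonneg n) hν0 (by linarith) (by norm_num : (0:ℝ) < 1 / 40)
    hte hlarge
  linarith


set_option maxHeartbeats 800000 in
open scoped Classical in
/-- **T4, DEGREE-LOCAL form** (`stub_perCharacterDeficit_of_density` with the density hypothesis at ONE degree `n`):
`LogFreeDensityCG(n) → PerCharacterDeficitκ(n)`.
The one-sided per-character deficit `8 · Re Σ_{N𝔭 prime ≤ x} χ([𝔭]) ≤ Li(x)` for `x ≥ Q^{C₂}`,
every `K` of degree `n > 1` with `κ_K ≥ Q^{−A}` and every `χ ≠ 1`, from the log-free zero-density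
estimate for the class group `L`-functions in degree `n` (tree: `logFreeDensity_classGroup n` for `n ≤ 4`). Real zeros are dropped by sign. -/
theorem perCharacterDeficit_of_density_local :
    ∀ n : ℕ, 1 < n → (∃ c_D C_D : ℝ, 0 < c_D ∧ 0 < C_D ∧
      ∀ (K : Type) [Field K] [NumberField K], Module.finrank ℚ K = n →
        (∀ χ : ClassGroup (𝓞 K) →* ℂˣ, χ ≠ 1 → ∀ ρ : ℂ,
          Literature.NumberTheory.LFunctions.NumberField.classGroupLFunction₀ K χ ρ = 0 → ρ.re < 1) →
        ∀ P : ℝ, 2 ≤ P → ((NumberField.discr K).natAbs : ℝ) ≤ P →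
          (Fintype.card (ClassGroup (𝓞 K)) : ℝ) ≤ P → P⁻¹ ≤ NumberField.dedekindZeta_residue K →
        ∀ Z : (ClassGroup (𝓞 K) →* ℂˣ) → Finset ℂ,
          (∀ χ : ClassGroup (𝓞 K) →* ℂˣ, χ ≠ 1 → ∀ ρ ∈ Z χ,
              Literature.NumberTheory.LFunctions.NumberField.classGroupLFunction₀ K χ ρ = 0 ∧
                1 / 4 ≤ ρ.re ∧ ρ.re < 1 ∧ |ρ.im| ≤ P) →
          ∀ α : ℝ, 0 ≤ α → α ≤ 1 →
            ∑ ψ : AddChar (Additive (ClassGroup (𝓞 K))) ℂ with ψ ≠ 0,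
              ∑ ρ ∈ Z (Literature.NumberTheory.LFunctions.AbelianDensity.toMulHom ψ).toHomUnits with α ≤ ρ.re,
                (Literature.NumberTheory.LFunctions.LogFreeLocal.zeroOrder
                  (Literature.NumberTheory.LFunctions.NumberField.classGroupLFunction₀ K
                    (Literature.NumberTheory.LFunctions.AbelianDensity.toMulHom ψ).toHomUnits) ρ : ℝ)
                  ≤ C_D * P ^ (c_D * (1 - α))) →
    ∀ A : ℝ, 0 ≤ A → ∃ C₂ : ℝ, ∀ (K : Type) [Field K] [NumberField K],
      Module.finrank ℚ K = n →
      Literature.NumberTheory.LFunctions.NumberField.ThornerZaman.condQn K ^ (-A) ≤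
        NumberField.dedekindZeta_residue K →
      ∀ χ : ClassGroup (𝓞 K) →* ℂˣ, χ ≠ 1 → ∀ x : ℝ,
      Literature.NumberTheory.LFunctions.NumberField.ThornerZaman.condQn K ^ C₂ ≤ x →
        8 * ∑ C : ClassGroup (𝓞 K), ((χ C : ℂ)).re * (degOneClassCount K C x : ℝ) ≤
          Literature.NumberTheory.LFunctions.offsetLogIntegral x := by
  intro n hn hD A _
  obtain ⟨a₂, ha₂, hθ⟩ := thetaChar_le_of_density_local n hn A hD
  refine ⟨max (2 * a₂) (4 * n + 16), fun K _ _ hKn hκ χ hχ x hx ↦ ?_⟩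
  have hK : 1 < Module.finrank ℚ K := by rw [hKn]; exact hn
  set Q : ℝ := ThornerZaman.condQn K with hQ
  have hQ12 : (12 : ℝ) ≤ Q := ThornerZaman.twelve_le_condQn (K := K) hK
  have hQ1 : (1 : ℝ) < Q := by linarith
  set C₂ : ℝ := max (2 * a₂) (4 * n + 16) with hC₂
  -- `Y = Q^{a₂}`, `Y² ≤ x`
  set Y : ℝ := Q ^ a₂ with hY
  have hYQ : Q ≤ Y := by
    have : Q ^ (1 : ℝ) ≤ Q ^ a₂ := Real.rpow_le_rpow_of_exponent_le hQ1.le ha₂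
    rwa [Real.rpow_one] at this
  have hY2 : (2 : ℝ) ≤ Y := by linarith
  have hY0 : 0 < Y := by linarith
  have hYYx : Y * Y ≤ x := by
    have : Q ^ (2 * a₂) ≤ Q ^ C₂ := Real.rpow_le_rpow_of_exponent_le hQ1.le (le_max_left _ _)
    rw [show (2 : ℝ) * a₂ = a₂ + a₂ by ring, Real.rpow_add (by linarith)] at this
    exact this.trans hx
  have hYx : Y ≤ x := by nlinarith
  have hYsqrt : Y ≤ Real.sqrt x := by
    rw [Real.le_sqrt hY0.le (by nlinarith)]; nlinarith
  -- `x ≥ 12^{4n+16} ≥ (10⁴(n+1))⁴`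
  have hxbig : (10000 * ((n:ℝ) + 1)) ^ 4 ≤ x := by
    have h1 : Q ^ ((4 * n + 16 : ℕ) : ℝ) ≤ x := by
      refine le_trans (Real.rpow_le_rpow_of_exponent_le hQ1.le ?_) hx
      push_cast; exact le_max_right _ _
    rw [Real.rpow_natCast] at h1
    have h2 : (12 : ℝ) ^ (4 * n + 16) ≤ Q ^ (4 * n + 16) := pow_le_pow_left₀ (by norm_num) hQ12 _
    have h3 : ((10000 * (n + 1)) ^ 4 : ℕ) ≤ 12 ^ (4 * n + 16) := pow_bound_twelve n
    have h4 : (((10000 * (n + 1)) ^ 4 : ℕ) : ℝ) ≤ ((12 ^ (4 * n + 16) : ℕ) : ℝ) := by exact_mod_cast h3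
    push_cast at h4
    linarith
  have hsize := size_ineq_deficit n hxbig
  have hn0 : (0 : ℝ) ≤ n := Nat.cast_nonneg n
  have hx256 : (256 : ℝ) ≤ x := by
    have h1 : (10000 : ℝ) ≤ 10000 * ((n : ℝ) + 1) := by nlinarith
    have h2 : (10000 : ℝ) ^ 4 ≤ (10000 * ((n : ℝ) + 1)) ^ 4 := pow_le_pow_left₀ (by norm_num) h1 4
    linarith [show (256 : ℝ) ≤ 10000 ^ 4 by norm_num]
  have hx0 : 0 ≤ x := by linarith
  have hx1 : 1 < x := by linarith
  have hlogx : 0 < Real.log x := Real.log_pos hx1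
  -- the θ-bound on `[Y, x]` and Chebyshev below `Y`
  have hup : ∀ t ∈ Set.Icc Y x, ∑ C, (χ C : ℂ).re * chebyshevThetaIdealClass K C t ≤ 1 / 20 * t :=
    fun t ht ↦ hθ K hKn hκ χ hχ t ht.1
  have hBt : ∀ t ∈ Set.Icc 2 Y, chebyshevThetaIdeal K t ≤ (n * (Real.log 4 + 4)) * t := by
    intro t ht
    have := chebyshevThetaIdeal_le_mul K (by linarith [ht.1] : (0:ℝ) ≤ t)
    rw [hKn] at this; exact this
  have hlog4 : Real.log 4 < 2 := by
    have : Real.log 4 = 2 * Real.log 2 := by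
      rw [show (4:ℝ) = 2 ^ 2 by norm_num, Real.log_pow]; norm_num
    rw [this]; have := Real.log_two_lt_d9; linarith
  have hB0 : 0 ≤ (n : ℝ) * (Real.log 4 + 4) := by
    have : 0 ≤ Real.log 4 := Real.log_nonneg (by norm_num)
    positivity
  -- partial summation for the signed count
  have hre1 : ∀ C : ClassGroup (𝓞 K), |((χ C : ℂ)).re| ≤ 1 := fun C ↦ abs_re_classGroupChar_le χ C
  have hPS := sum_mul_primeIdealClassCount_le (K := K) (fun C ↦ (χ C : ℂ).re) hre1 hY2 hYx
    (by norm_num : (0:ℝ) ≤ 1 / 20) hB0 hup hBt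
  -- degree-one counts versus all primes, class by class
  have hS := sum_re_mul_le_add (fun C : ClassGroup (𝓞 K) => ((χ C : ℂ)).re)
    (fun C => (degOneClassCount K C x : ℝ)) (fun C => (primeIdealClassCount K C x : ℝ)) hre1
    (fun C => by exact_mod_cast degOneClassCount_le K C x)
  beta_reduce at hS
  have hdeg := primeIdealCount_le_sum_degOneClassCount_add K hx0
  rw [hKn] at hdeg
  have htot : (primeIdealCount K x : ℝ) = ∑ C : ClassGroup (𝓞 K), (primeIdealClassCount K C x : ℝ) := by
    rw [← sum_primeIdealClassCount (K := K) x]; push_cast; rfl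
  -- `Li(x) ≥ x/(2 log x)`
  have hLi : x / (2 * Real.log x) ≤ offsetLogIntegral x := div_two_mul_log_le_offsetLogIntegral hx256
  -- assembly
  have hsqrt0 : 0 ≤ Real.sqrt x := Real.sqrt_nonneg _
  have hns0 : 0 ≤ (n : ℝ) * Real.sqrt x := mul_nonneg hn0 hsqrt0
  have hBY : 3 * ((n : ℝ) * (Real.log 4 + 4)) * Y ≤ 18 * ((n : ℝ) * Real.sqrt x) := by
    have h1 : (n : ℝ) * (Real.log 4 + 4) ≤ 6 * n := by nlinarith
    have h2 : 3 * ((n : ℝ) * (Real.log 4 + 4)) * Y ≤ 3 * (6 * n) * Y :=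
      mul_le_mul_of_nonneg_right (by linarith) hY0.le
    have h3 : 3 * (6 * (n : ℝ)) * Y ≤ 3 * (6 * n) * Real.sqrt x :=
      mul_le_mul_of_nonneg_left hYsqrt (by positivity)
    linarith
  have hxlog : x / (2 * Real.log x) = 1 / 2 * (x / Real.log x) := by ring
  rw [hxlog] at hLi
  have e1 : (n : ℝ) * (Real.sqrt x + 1) = n * Real.sqrt x + n := by ring
  rw [e1] at hdeg
  linarith [hS, hPS, hdeg, htot, hLi, hsize, hBY, hsqrt0, hn0, hns0]


open scoped Classical in
/-- **The per-character deficit at degrees `1 < n ≤ 4`, with the residue hypothesis only**: the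
density hypothesis of `perCharacterDeficit_of_density_local` is the tree's `logFreeDensity_classGroup n`. -/
theorem perCharacterDeficitκ_of_le_four (n : ℕ) (hn : 1 < n) (hn4 : n ≤ 4) (A : ℝ) (hA : 0 ≤ A) :
    ∃ C₂ : ℝ, ∀ (K : Type) [Field K] [NumberField K], Module.finrank ℚ K = n →
      ThornerZaman.condQn K ^ (-A) ≤ NumberField.dedekindZeta_residue K →
      ∀ χ : ClassGroup (𝓞 K) →* ℂˣ, χ ≠ 1 → ∀ x : ℝ, ThornerZaman.condQn K ^ C₂ ≤ x →
        8 * ∑ C : ClassGroup (𝓞 K), ((χ C : ℂ)).re * (degOneClassCount K C x : ℝ) ≤ offsetLogIntegral x :=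
  perCharacterDeficit_of_density_local n hn (logFreeDensity_classGroup n hn4) A hA

end Summit.QuantumAdvantage.QuantumAdvantage.Theorems.DegreeOnePrimesEscape

end
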